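import Summits.Ventures.CertifiedArithmetic.LowPrec.OptTreePolySignedHeightTwo

/-!
# The inflation-aware height bound for signed summation under ties-to-even

HONEST FRAMING (venture CertifiedArithmetic / cell `pub-lowprec`): certified error envelopes and
provably optimal rounding/accumulation schemes for low-precision formats under stated cost models;
every table by two implementations; no hardware or vendor claims.

`OptTreePolySignedHeightTwo` proved the signed tree-polynomial law for the balanced four-leaf tree
from three facts about one rounded addition `X = fl(x)` (`x` a sum of two data, in range):
(N) `|X - x| ≤ v|x|`, `v = u/(1+u)` [JeannerodRump2018, (4.1)]; (I) `|X| > |x| ⟹ |X - x| ≤ w|x|`,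
`w = u/(1+2u+2u²)` (the RNE inflation asymmetry, `RoundNearestInflation`); (S) weak sign
preservation.  THIS FILE is the general theorem those three facts give, for EVERY tree and signed
data, by one induction with a two-parameter linear potential:

  **`|ŝ - s| ≤ max(1 - (1-v)^h, (1+w)^h - 1) · Σ|xᵢ|`,  `h` = height of the tree**

(`abs_eval_sub_exact_le_inflation_height`, every format with `m ≥ 1`, every node in range).  The
invariant (`signed_height_invariant`): for all rationals `A, B`,
`A·(s - ŝ) + B·s ≤ max(|B + A·D_h|, |B - A·I_h|)·Σ|xᵢ|` with `D_h = 1 - (1-v)^h` (all-deflation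
chain) and `I_h = (1+w)^h - 1` (all-inflation chain).  At a node the local error `d = g - fl g` obeys
`A·d ≤ max(A·v·g, -A·w·g, 0)` for every `A` (`node_error_le` — this is (N)(I)(S) and nothing
else), which transforms `(A, B)` into `(A(1-v), B + Av)`, `(A(1+w), B - Aw)` or `(A, B)`; each lands
in the segment between the two chains, and `|B + A·c| ≤ max(|B + A·D|, |B - A·I|)` for
`-I ≤ c ≤ D` (`abs_affine_le_max`) closes the induction.

READING.  `D_h ≤ I_h`-or-not decides the regime: for `h ≤ 2`, `I_h ≤ D_h` (`two_infl_le_law`) and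
the bound IS the tree-polynomial law `1 - 1/(1+u)^h` of the balanced tree, attained (the four-leaf
theorem is the case `h = 2`: `max_height_two`); for `h ≥ 3` and small `u` the all-inflation chain
`(1+w)^h - 1` is the larger — the relaxation's value, NOT claimed sharp (Conjecture S′ says the
truth is `D_h` for balanced trees; a proof must use the grid, `relaxation_exceeds_law_height_three`).
Since `w ≤ v`, both chains are `≤ (1+v)^h - 1`, the balanced tree's `M_t(v) - 1`
(`OptTreePolySignedUpper`): the signed sandwich for balanced trees tightens to
`1 - (1-v)^h ≤ W_h ≤ max(1 - (1-v)^h, (1+w)^h - 1)` (`inflation_height_le_sandwich`), a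
second-order gain; numerically (E4M3, `h = 3`): `0.16629 ≤ W₃ ≤ 0.17479 < 0.18714`.  For chains
the bound is weak (it ignores that an addition never errs by more than its smaller operand —
Lange–Rump's `h·u` needs that); it is a statement about balanced/blocked reduction trees.
Placement: height bounds `(1+u)^h - 1` [Higham2002ASNA, (4.6)], `h·u` under `(h+1)²u ≤ 1`
[LangeRump2018 / BJMM 2023 Thm 4.4] are KNOWN; the ties-to-even constant `w` in a height bound and
the `h ≤ 2` exactness are this cell's, new as far as searched (OPTIMA §T(f) sweep; corpus hybrid
search "inflation / ties-to-even summation height bound" 2026-08-20: none).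
-/

namespace Summit.Ventures.CertifiedArithmetic.LowPrec.Opt

open Literature.ComputerArithmetic.JeannerodRump2018
open Literature.ComputerArithmetic.JeannerodRump2018.SumTree
open Literature.ComputerArithmetic.FloatingPoint
open Literature.ComputerArithmetic.FloatingPoint.MiniFloat

/-! ## §1 Two elementary inequalities -/

/-- SEGMENT LEMMA: if `-I ≤ c ≤ D` then `|B + A·c| ≤ max(|B + A·D|, |B - A·I|)` (the point
`B + A·c` lies between the two endpoints, whatever the sign of `A`). -/
theorem abs_affine_le_max {A B c D I : ℚ} (hcD : c ≤ D) (hIc : -I ≤ c) :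
    |B + A * c| ≤ max |B + A * D| |B - A * I| := by
  rcases le_or_gt 0 A with hA | hA
  · have h1 : B - A * I ≤ B + A * c := by nlinarith [mul_le_mul_of_nonneg_left hIc hA]
    have h2 : B + A * c ≤ B + A * D := by nlinarith [mul_le_mul_of_nonneg_left hcD hA]
    rw [max_comm]; exact abs_le_max_abs_abs h1 h2
  · have h1 : B + A * D ≤ B + A * c := by nlinarith
    have h2 : B + A * c ≤ B - A * I := by nlinarith
    exact abs_le_max_abs_abs h1 h2

/-- THE NODE INEQUALITY from (N)(I)(S): for one rounded addition `X = fl(g)` with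
`|X - g| ≤ v|g|`, `|g| < |X| → |X - g| ≤ w|g|` and weak sign preservation, and for EVERY rational
`A`: `A·(g - X) ≤ max(A·v·g, -(A·w·g), 0)` — a deflation is worth `v·g` to a positive multiplier,
an inflation `w·|g|` to a negative one, and nothing else helps. -/
theorem node_error_le {v w g X A : ℚ} (hN : |X - g| ≤ v * |g|)
    (hI : |g| < |X| → |X - g| ≤ w * |g|) (hSp : 0 ≤ g → 0 ≤ X) (hSm : g ≤ 0 → X ≤ 0) :
    A * (g - X) ≤ max (A * v * g) (max (-(A * w * g)) 0) := by
  rcases le_or_gt (A * (g - X)) 0 with h0 | h0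
  · exact le_trans h0 (le_trans (le_max_right _ _) (le_max_right _ _))
  rcases lt_trichotomy g 0 with hg | hg | hg
  · have hX := hSm hg.le
    rcases le_or_gt (g - X) 0 with hd | hd
    · -- `X ≥ g`, `X ≤ 0`: deflation of a negative argument, `A < 0`
      have hA : A ≤ 0 := by
        by_contra hA'
        have : A * (g - X) ≤ 0 := mul_nonpos_of_nonneg_of_nonpos (le_of_lt (not_le.mp hA')) hd
        linarith
      have h1 : X - g ≤ v * (-g) := by
        rw [abs_of_neg hg] at hN; exact le_trans (le_abs_self _) hN
      have : A * (g - X) ≤ A * v * g := by nlinarith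
      exact le_trans this (le_max_left _ _)
    · -- `X < g < 0`: inflation, `A > 0`
      have hA : 0 ≤ A := by
        by_contra hA'
        have : A * (g - X) ≤ 0 := mul_nonpos_of_nonpos_of_nonneg (le_of_lt (not_le.mp hA')) hd.le
        linarith
      have hinf : |g| < |X| := by rw [abs_of_neg hg, abs_of_nonpos hX]; linarith
      have h1 := hI hinf
      rw [abs_of_neg hg, abs_of_nonpos (by linarith : X - g ≤ 0)] at h1
      have : A * (g - X) ≤ -(A * w * g) := by nlinarith
      exact le_trans this (le_trans (le_max_left _ _) (le_max_right _ _))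
  · exfalso
    have h1 := hSp hg.ge
    have h2 := hSm hg.le
    have : X = 0 := le_antisymm h2 h1
    rw [hg, this] at h0; simp at h0
  · have hX := hSp hg.le
    rcases le_or_gt (g - X) 0 with hd | hd
    · -- `X ≥ g > 0`: inflation, `A < 0`
      have hA : A ≤ 0 := by
        by_contra hA'
        have : A * (g - X) ≤ 0 := mul_nonpos_of_nonneg_of_nonpos (le_of_lt (not_le.mp hA')) hd
        linarith
      rcases eq_or_lt_of_le hd with heq | hlt
      · rw [heq, mul_zero] at h0; exact absurd h0 (lt_irrefl _)
      have hinf : |g| < |X| := by rw [abs_of_pos hg, abs_of_nonneg hX]; linarith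
      have h1 := hI hinf
      rw [abs_of_pos hg, abs_of_nonneg (by linarith : 0 ≤ X - g)] at h1
      have : A * (g - X) ≤ -(A * w * g) := by nlinarith
      exact le_trans this (le_trans (le_max_left _ _) (le_max_right _ _))
    · -- `X < g`, `X ≥ 0`: deflation, `A > 0`
      have hA : 0 ≤ A := by
        by_contra hA'
        have : A * (g - X) ≤ 0 := mul_nonpos_of_nonpos_of_nonneg (le_of_lt (not_le.mp hA')) hd.le
        linarith
      have h1 : g - X ≤ v * g := by
        rw [abs_of_pos hg] at hN
        have := le_abs_self (X - g); rw [abs_sub_comm] at this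
        have := neg_abs_le (X - g); linarith [abs_sub_comm X g]
      have : A * (g - X) ≤ A * v * g := by nlinarith
      exact le_trans this (le_max_left _ _)

/-! ## §2 The chains `D_h = 1 - (1-v)^h`, `I_h = (1+w)^h - 1` -/

/-- Both chains are nonnegative and nondecreasing in `h` (`0 ≤ v ≤ 1`, `0 ≤ w`). -/
theorem chains_mono {v w : ℚ} (hv0 : 0 ≤ v) (hv1 : v ≤ 1) (hw0 : 0 ≤ w) {h h' : ℕ} (hh : h' ≤ h) :
    0 ≤ 1 - (1 - v) ^ h' ∧ 1 - (1 - v) ^ h' ≤ 1 - (1 - v) ^ h ∧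
      0 ≤ (1 + w) ^ h' - 1 ∧ (1 + w) ^ h' - 1 ≤ (1 + w) ^ h - 1 := by
  have h1 : (1 - v) ^ h ≤ (1 - v) ^ h' := pow_le_pow_of_le_one (by linarith) (by linarith) hh
  have h2 : (1 - v) ^ h' ≤ 1 := pow_le_one₀ (by linarith) (by linarith)
  have h3 : (1 : ℚ) ≤ (1 + w) ^ h' := one_le_pow₀ (by linarith)
  have h4 : (1 + w) ^ h' ≤ (1 + w) ^ h := pow_le_pow_right₀ (by linarith) hh
  refine ⟨by linarith, by linarith, by linarith, by linarith⟩

/-- The bound `max(|B + A·D_h|, |B - A·I_h|)` is nondecreasing in `h`. -/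
theorem potential_mono {v w : ℚ} (hv0 : 0 ≤ v) (hv1 : v ≤ 1) (hw0 : 0 ≤ w) {h h' : ℕ}
    (hh : h' ≤ h) (A B : ℚ) :
    max |B + A * (1 - (1 - v) ^ h')| |B - A * ((1 + w) ^ h' - 1)|
      ≤ max |B + A * (1 - (1 - v) ^ h)| |B - A * ((1 + w) ^ h - 1)| := by
  obtain ⟨hD0, hDD, hI0, hII⟩ := chains_mono hv0 hv1 hw0 hh
  obtain ⟨hD0', -, hI0', -⟩ := chains_mono hv0 hv1 hw0 (le_refl h)
  refine max_le ?_ ?_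
  · exact abs_affine_le_max hDD (by linarith)
  · rw [show B - A * ((1 + w) ^ h' - 1) = B + A * (-((1 + w) ^ h' - 1)) by ring]
    exact abs_affine_le_max (by linarith) (by linarith)

/-- ONE LEVEL OF THE RECURSION: the three moves `(A,B) ↦ (A(1-v), B+Av)` (deflation),
`(A(1+w), B-Aw)` (inflation), `(A,B)` (no error) send the level-`h` potential into the
level-`(h+1)` potential. -/
theorem potential_step {v w : ℚ} (hv0 : 0 ≤ v) (hv1 : v ≤ 1) (hw0 : 0 ≤ w) (h : ℕ) (A B : ℚ) :
    max |(B + A * v) + A * (1 - v) * (1 - (1 - v) ^ h)|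
        |(B + A * v) - A * (1 - v) * ((1 + w) ^ h - 1)|
      ≤ max |B + A * (1 - (1 - v) ^ (h + 1))| |B - A * ((1 + w) ^ (h + 1) - 1)| ∧
    max |(B - A * w) + A * (1 + w) * (1 - (1 - v) ^ h)|
        |(B - A * w) - A * (1 + w) * ((1 + w) ^ h - 1)|
      ≤ max |B + A * (1 - (1 - v) ^ (h + 1))| |B - A * ((1 + w) ^ (h + 1) - 1)| ∧
    max |B + A * (1 - (1 - v) ^ h)| |B - A * ((1 + w) ^ h - 1)|
      ≤ max |B + A * (1 - (1 - v) ^ (h + 1))| |B - A * ((1 + w) ^ (h + 1) - 1)| := by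
  obtain ⟨hD0, -, hI0, -⟩ := chains_mono hv0 hv1 hw0 (le_refl h)
  obtain ⟨hD0', -, hI0', -⟩ := chains_mono hv0 hv1 hw0 (le_refl (h + 1))
  set D := 1 - (1 - v) ^ h with hD
  set I := (1 + w) ^ h - 1 with hI
  have hD1 : D ≤ 1 := by
    have : 0 ≤ (1 - v) ^ h := pow_nonneg (by linarith) h
    rw [hD]; linarith
  have hDs : 1 - (1 - v) ^ (h + 1) = v + (1 - v) * D := by rw [hD, pow_succ]; ring
  have hIs : (1 + w) ^ (h + 1) - 1 = w + (1 + w) * I := by rw [hI, pow_succ]; ring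
  rw [hDs, hIs]
  refine ⟨max_le ?_ ?_, max_le ?_ ?_, potential_mono hv0 hv1 hw0 (Nat.le_succ h) A B |>.trans ?_⟩
  · -- deflation move, D-chain: exact
    rw [show B + A * v + A * (1 - v) * D = B + A * (v + (1 - v) * D) by ring]
    exact le_max_left _ _
  · -- deflation move, I-chain: lands inside the segment
    rw [show B + A * v - A * (1 - v) * I = B + A * (v - (1 - v) * I) by ring]
    refine abs_affine_le_max ?_ ?_
    · nlinarith [mul_nonneg (by linarith : (0:ℚ) ≤ 1 - v) hI0]
    · nlinarith [mul_nonneg hv0 hI0, mul_nonneg hw0 hI0]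
  · -- inflation move, D-chain: inside the segment
    rw [show B - A * w + A * (1 + w) * D = B + A * ((1 + w) * D - w) by ring]
    refine abs_affine_le_max ?_ ?_
    · nlinarith [mul_nonneg hw0 (by linarith : (0:ℚ) ≤ 1 - D), mul_nonneg hv0 (by linarith : (0:ℚ) ≤ 1 - D)]
    · nlinarith [mul_nonneg hw0 hD0, mul_nonneg hw0 hI0]
  · -- inflation move, I-chain: exact
    rw [show B - A * w - A * (1 + w) * I = B - A * (w + (1 + w) * I) by ring]
    exact le_max_right _ _
  · rw [← hDs, ← hIs]

/-! ## §3 The invariant and the theorem, in every format -/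

/-- **THE SIGNED HEIGHT INVARIANT** (format `α`, `m ≥ 1`): for every evaluation tree whose leaves
are values of `α` (any signs) and whose every node stays in range, and for ALL rationals `A, B`,
`A·(s - ŝ) + B·s ≤ max(|B + A·(1 - (1-v)^h)|, |B - A·((1+w)^h - 1)|) · Σ|xᵢ|`,
`h = height`, `v = u/(1+u)`, `w = u/(1+2u+2u²)`. -/
theorem signed_height_invariant (α : Format) (hm : 1 ≤ α.manBits) :
    ∀ t : SumTree, TreeInRange α t → ∀ A B : ℚ,
      A * (exact t - eval (flα α) t) + B * exact t
        ≤ max |B + A * (1 - (1 - α.unitRoundoff / (1 + α.unitRoundoff)) ^ height t)|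
              |B - A * ((1 + α.unitRoundoff / (1 + 2 * α.unitRoundoff + 2 * α.unitRoundoff ^ 2))
                    ^ height t - 1)| * absSum t
  | .leaf x, _, A, B => by
      have hL : absSum (leaf x) = |x| := by simp [absSum, leaves]
      simp only [exact, eval, sub_self, mul_zero, zero_add, height_leaf, pow_zero, add_zero,
        sub_zero, max_self, hL]
      rw [← abs_mul]
      exact le_abs_self _
  | .node l r, ht, A, B => by
      have ht' := ht
      simp only [TreeInRange] at ht'
      obtain ⟨hl, hr, hrange⟩ := ht'
      obtain ⟨yl, hyl⟩ := exists_toRat_eq_eval l hl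
      obtain ⟨yr, hyr⟩ := exists_toRat_eq_eval r hr
      have hrange' : |yl.toRat + yr.toRat| ≤ α.maxRat := by rw [hyl, hyr]; exact hrange
      obtain ⟨hN, hI, hSp, hSm⟩ := flα_addition_facts α hm yl yr hrange'
      rw [hyl, hyr] at hN hI hSp hSm
      have IHl := signed_height_invariant α hm l hl
      have IHr := signed_height_invariant α hm r hr
      have hu := format_unitRoundoff_nonneg α
      obtain ⟨hw0, -, hv0, hv1⟩ := rates_basic hu
      simp only [exact, eval, height_node, absSum_node]
      -- notation (introduced after all hypotheses, so that `set` abbreviates them too)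
      set u := α.unitRoundoff with hu_def
      set v := u / (1 + u) with hv_def
      set w := u / (1 + 2 * u + 2 * u ^ 2) with hw_def
      set g := eval (flα α) l + eval (flα α) r with hg
      set X := flα α g with hX
      set H := max (height l) (height r) with hH
      have hLl := absSum_nonneg l
      have hLr := absSum_nonneg r
      -- the node inequality
      have hnode := node_error_le (A := A) hN hI hSp hSm
      -- split `A(s - X) + B s` through `g`
      have key : A * (exact l + exact r - X) + B * (exact l + exact r)
          = A * ((exact l - eval (flα α) l) + (exact r - eval (flα α) r)) + A * (g - X)
            + B * (exact l + exact r) := by rw [hg]; ring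
      rw [key]
      obtain ⟨stepD, stepI, stepZ⟩ := potential_step hv0 hv1 hw0 H A B
      -- children bounds at level `H` for given parameters
      have child : ∀ A' B' : ℚ,
          A' * ((exact l - eval (flα α) l) + (exact r - eval (flα α) r)) + B' * (exact l + exact r)
            ≤ max |B' + A' * (1 - (1 - v) ^ H)| |B' - A' * ((1 + w) ^ H - 1)|
                * (absSum l + absSum r) := by
        intro A' B'
        have h1 := le_trans (IHl A' B')
          (mul_le_mul_of_nonneg_right (potential_mono hv0 hv1 hw0 (le_max_left (height l) (height r)) A' B') hLl)
        have h2 := le_trans (IHr A' B')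
          (mul_le_mul_of_nonneg_right (potential_mono hv0 hv1 hw0 (le_max_right (height l) (height r)) A' B') hLr)
        rw [← hH] at h1 h2
        nlinarith
      rcases le_total (A * (g - X)) 0 with h0 | h0'
      · -- no help from the node
        have := child A B
        nlinarith [mul_le_mul_of_nonneg_right stepZ (add_nonneg hLl hLr)]
      · have hmax := hnode
        rcases le_total (A * v * g) (max (-(A * w * g)) 0) with hc | hc
        · rw [max_eq_right hc] at hmax
          rcases le_total (-(A * w * g)) 0 with hc' | hc'
          · rw [max_eq_right hc'] at hmax
            have := child A B
            nlinarith [mul_le_mul_of_nonneg_right stepZ (add_nonneg hLl hLr)]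
          · -- inflation move
            rw [max_eq_left hc'] at hmax
            have hgX : A * (g - X) ≤ -(A * w) * ((exact l + exact r)
                - ((exact l - eval (flα α) l) + (exact r - eval (flα α) r))) := by
              rw [show (exact l + exact r) - ((exact l - eval (flα α) l)
                + (exact r - eval (flα α) r)) = g by rw [hg]; ring]
              linarith
            have := child (A * (1 + w)) (B - A * w)
            nlinarith [mul_le_mul_of_nonneg_right stepI (add_nonneg hLl hLr)]
        · -- deflation move
          rw [max_eq_left hc] at hmax
          have hgX : A * (g - X) ≤ (A * v) * ((exact l + exact r)
              - ((exact l - eval (flα α) l) + (exact r - eval (flα α) r))) := by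
            rw [show (exact l + exact r) - ((exact l - eval (flα α) l)
              + (exact r - eval (flα α) r)) = g by rw [hg]; ring]
            linarith
          have := child (A * (1 - v)) (B + A * v)
          nlinarith [mul_le_mul_of_nonneg_right stepD (add_nonneg hLl hLr)]

/-- **THE INFLATION-AWARE HEIGHT BOUND** (every format with `m ≥ 1`, every evaluation tree with
leaves in `F_α` of ANY signs and all nodes in range):
`|ŝ - s| ≤ max(1 - (1-v)^h, (1+w)^h - 1) · Σ|xᵢ|`, `h` = height, `v = u/(1+u)`,
`w = u/(1+2u+2u²)`.  Balanced (pairwise) summation of `n = 2^h` terms has `h = log₂ n`. -/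
theorem abs_eval_sub_exact_le_inflation_height (α : Format) (hm : 1 ≤ α.manBits) (t : SumTree)
    (ht : TreeInRange α t) :
    |eval (flα α) t - exact t|
      ≤ max (1 - (1 - α.unitRoundoff / (1 + α.unitRoundoff)) ^ height t)
            ((1 + α.unitRoundoff / (1 + 2 * α.unitRoundoff + 2 * α.unitRoundoff ^ 2))
                ^ height t - 1) * absSum t := by
  have hu := format_unitRoundoff_nonneg α
  obtain ⟨hw0, -, hv0, hv1⟩ := rates_basic hu
  obtain ⟨hD0, -, hI0, -⟩ := chains_mono hv0 hv1 hw0 (le_refl (height t))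
  have h1 := signed_height_invariant α hm t ht 1 0
  have h2 := signed_height_invariant α hm t ht (-1) 0
  simp only [one_mul, zero_mul, add_zero, zero_add, zero_sub, neg_mul, one_mul, sub_neg_eq_add,
    abs_neg] at h1 h2
  rw [abs_of_nonneg hD0, abs_of_nonneg hI0] at h1 h2
  rw [abs_sub_comm, abs_le]
  constructor <;> linarith

/-! ## §4 Reading the bound -/

/-- AT HEIGHT ≤ 2 THE BOUND IS THE TREE-POLYNOMIAL LAW: `(1+w)² - 1 ≤ 1 - (1-v)²` (and the same at
height `1`), so `max(D_h, I_h) = D_h = 1 - 1/(1+u)^h` for `h ≤ 2` — the four-leaf theorem of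
`OptTreePolySignedHeightTwo` is the case `h = 2`. -/
theorem max_height_two {u : ℚ} (hu : 0 ≤ u) :
    max (1 - (1 - u / (1 + u)) ^ 2) ((1 + u / (1 + 2 * u + 2 * u ^ 2)) ^ 2 - 1)
        = 1 - 1 / (1 + u) ^ 2 ∧
    max (1 - (1 - u / (1 + u)) ^ 1) ((1 + u / (1 + 2 * u + 2 * u ^ 2)) ^ 1 - 1)
        = u / (1 + u) := by
  obtain ⟨hw0, hwv, hv0, hv1⟩ := rates_basic hu
  have hP := two_infl_le_law hu
  obtain ⟨hlaw, -⟩ := law_height_two_eq hu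
  constructor
  · rw [max_eq_left]
    · rw [← hlaw]; ring
    · nlinarith
  · rw [pow_one, pow_one, max_eq_left] <;> linarith

/-- BOTH CHAINS ARE BELOW THE SANDWICH'S `(1+v)^h - 1` (`= M_t(v) - 1` of the balanced tree of
height `h`, `OptTreePolySignedUpper`): the inflation-aware bound refines the signed sandwich for
balanced trees, `1 - (1-v)^h ≤ W_h ≤ max(1 - (1-v)^h, (1+w)^h - 1) ≤ (1+v)^h - 1`. -/
theorem inflation_height_le_sandwich {u : ℚ} (hu : 0 ≤ u) (h : ℕ) :
    max (1 - (1 - u / (1 + u)) ^ h) ((1 + u / (1 + 2 * u + 2 * u ^ 2)) ^ h - 1)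
      ≤ (1 + u / (1 + u)) ^ h - 1 := by
  obtain ⟨hw0, hwv, hv0, hv1⟩ := rates_basic hu
  refine max_le ?_ ?_
  · -- 1 - (1-v)^h ≤ (1+v)^h - 1, i.e. 2 ≤ (1-v)^h + (1+v)^h
    have key : ∀ k : ℕ, 2 ≤ (1 - u / (1 + u)) ^ k + (1 + u / (1 + u)) ^ k ∨ k = 0 := by
      intro k
      induction k with
      | zero => right; rfl
      | succ k ih =>
          left
          rcases ih with ih | ih
          · have h1 : (1 - u / (1 + u)) ^ k ≤ (1 + u / (1 + u)) ^ k :=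
              pow_le_pow_left₀ (by linarith) (by linarith) k
            have h2 : 0 ≤ (1 - u / (1 + u)) ^ k := pow_nonneg (by linarith) k
            rw [pow_succ, pow_succ]
            nlinarith
          · subst ih; norm_num
    rcases key h with hk | hk
    · linarith
    · subst hk; norm_num
  · have := pow_le_pow_left₀ (by linarith : (0:ℚ) ≤ 1 + u / (1 + 2 * u + 2 * u ^ 2))
      (by linarith : 1 + u / (1 + 2 * u + 2 * u ^ 2) ≤ 1 + u / (1 + u)) h
    linarith

/-- NUMBERS (E4M3 `u = 2^-4`, bfloat16 `u = 2^-8`; height `3`, i.e. eight leaves): the law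
`1 - (1-v)³`, the inflation-aware bound `(1+w)³ - 1`, and the sandwich `(1+v)³ - 1` are
`817/4913 < 532952/3048625 < 919/4913` (`0.1663 < 0.1748 < 0.1871`); at `u = 2^-8` the same strict chain. -/
theorem height_three_numbers :
    (1 - (1 - (1/16 : ℚ) / (1 + 1/16)) ^ 3 : ℚ) = 817 / 4913 ∧
    ((1 + (1/16 : ℚ) / (1 + 2 * (1/16) + 2 * (1/16) ^ 2)) ^ 3 - 1 : ℚ) = 532952 / 3048625 ∧
    ((1 + (1/16 : ℚ) / (1 + 1/16)) ^ 3 - 1 : ℚ) = 919 / 4913 ∧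
    (817 / 4913 : ℚ) < 532952 / 3048625 ∧ (532952 / 3048625 : ℚ) < 919 / 4913 ∧
    (1 - (1 - (1/256 : ℚ) / (1 + 1/256)) ^ 3 : ℚ)
      < (1 + (1/256 : ℚ) / (1 + 2 * (1/256) + 2 * (1/256) ^ 2)) ^ 3 - 1 ∧
    ((1 + (1/256 : ℚ) / (1 + 2 * (1/256) + 2 * (1/256) ^ 2)) ^ 3 - 1 : ℚ)
      < (1 + (1/256 : ℚ) / (1 + 1/256)) ^ 3 - 1 := by
  norm_num

end Summit.Ventures.CertifiedArithmetic.LowPrec.Opt
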